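import Mathlib
import Summits.Ventures.HodgeRepro.Tier4.Common.KTypeSpace
import Summits.Ventures.HodgeRepro.Tier4.Line4.KTypeJoint
import Summits.Ventures.HodgeRepro.Tier4.Line4.KTypeJointRational
import Summits.Ventures.HodgeRepro.Tier4.Line4.AtInfinitePlace

/-!
# Tier4/Line4/KTypeJointWitness — an explicit `(T, T′)`-word with weight defect on a seesaw plane: the joint `K`-type
space `kTypeSpace` is `⊥` for every `V` and every level `K`

Blind re-derivation cell `pub-hodge-repro`, Tier 4 «prove the step» (README §9–§10), seat t4-L4-p2 (prover, LINE L4,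
gen 3; bus S13737 / S13765).  Tree path `lean/Summits/Ventures/HodgeRepro/Tier4/Line4/KTypeJointWitness.lean`.
Mathlib-level; no literature.  Inputs: `Line4/KTypeJoint` (the general vanishing from a word, p684510),
`Line4/KTypeJointRational` (the rational boost `g₀`, the torus elements `κ₁, κ₂, κ₃`, the transported `κ₂'`, the relation
`κ₁ κ₂' κ₃ κ₂' = 1`), `Line4/AtInfinitePlace` (`gaAtInf`: a `k`-matrix placed at one infinite place).

WHAT IS PROVED.  On `W₀ := (PlaneData.mixedRow q₀ 1 1).withTransportedTorus g₀ g₀' …` — the shape `seesawPlane q a g g'`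
of the L4 skeleton (Skeleton v0.20 L412–L416, a `rfl` there) with `q = q₀ = ⟨0, 1⟩`, `a = 1`, `g = g₀`, `g' = g₀'` — and
at ANY infinite place `w₀` of ANY number field `k`:
* the four letters `L₁ = diag(−w, −w̄)`, `L₂ = g₀ diag(u, ū) g₀'`, `L₃ = diag(w, w̄)`, `L₂` placed at `w₀` form a
  `(T, T′)`-word (`theWord_isJointWord`: `L₁, L₃ ∈ localTorusAt W₀ w₀`, `L₂ ∈ localTorusAt' W₀ w₀`) of product `1`
  (`theWord_prod`);
* its weights (`weightAt`, `weightAt'` evaluated through `entryAt` / `entryAtConj` and `wroot q₀ w₀ = i`) are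
  `(−w)^{eP − eM}`, `u^{eP′ − eM′}`, `w^{eP − eM}`, `u^{eP′ − eM′}` at `w₀`, and for `eP w₀ − eM w₀ = ±3` (the wall's
  `_he`) and `eP′ w₀ − eM′ w₀ = ±3` (`_he'` with `λ = 1`) their product is `≠ 1` (`wordWeight_theWord_ne_one`: its real
  part is `−0.929…` or `−0.106…`, exact Gaussian-rational arithmetic);
* hence **`kTypeSpace W₀ q₀ g₀ g₀' eP eM eP' eM' K V = ⊥` for EVERY `V` and EVERY level `K`** (`kTypeSpace_witness_eq_bot`),
  the wall's Riesz clause `∃ f, IsRieszVectorOn R μ DG (kTypeSpace …) f` is FALSE for every `R`, `μ`, `D_G`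
  (`not_exists_isRieszVectorOn_witness`), and every function left-equivariant under both local tori at `w₀` with these
  weights is `0` (`eq_zero_of_left_equivariant_witness`).
SCOPE.  `q₀` describes a CM extension `E/k` (the skeleton's `DescribesCM`) iff `i ∈ E`; the similitude binder holds with
`λ = 1` (`g₀_hiso`), `a = 1` is non-zero and positive at every real place; the measure / character binders of the wall
(`R`, `μ`, `D_G`, `χ`, `χ′`, …) are NOT instantiated here — the statements hold for all of them.  This module is the
explicit half of the finding S13765: the joint `(T, T′)`-equivariance of `kTypeSpace` at `w₀` has only the zero vector on
a seesaw plane whose transported torus at `w₀` differs from `T_{w₀}`.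

Nothing here says anything about the status of the Hodge conjecture for CM abelian varieties, which is NOT proved
(HC_CM is NOT proved by anyone in this repository).
-/

set_option autoImplicit false

noncomputable section

namespace Summit.Ventures.HodgeRepro.Tier4.Line4

open Summit.Ventures.HodgeRepro.Tier4.Common NumberField Matrix

section Witness

open scoped Classical ComplexConjugate

variable {k : Type} [Field k] [NumberField k]

/-- The inverse of `κ₁` (`diag(−w̄, −w)`). -/
def κ₁' : Matrix (Fin 4) (Fin 4) k := torMat (-84 / 85) (13 / 85) (-84 / 85) (-13 / 85)

/-- The inverse of `κ₃` (`diag(w̄, w)`). -/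
def κ₃' : Matrix (Fin 4) (Fin 4) k := torMat (84 / 85) (-13 / 85) (84 / 85) (13 / 85)

/-- The inverse of `κ₂'` (`= g₀ diag(ū, u) g₀'`, written out). -/
def κ₂'' : Matrix (Fin 4) (Fin 4) k :=
  !![533 / 925, 3444 / 925, 0, -672 / 185; -3444 / 925, 533 / 925, 672 / 185, 0;
    0, 672 / 185, 533 / 925, -3444 / 925; -672 / 185, 0, 3444 / 925, 533 / 925]

/-- `κ₁ κ₁' = 1`. -/
theorem κ₁_mul_κ₁' : (κ₁ : Matrix (Fin 4) (Fin 4) k) * κ₁' = 1 := by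
  ext i j
  fin_cases i <;> fin_cases j <;> norm_num [κ₁, κ₁', torMat, Matrix.mul_apply, Fin.sum_univ_succ]

/-- `κ₁' κ₁ = 1`. -/
theorem κ₁'_mul_κ₁ : (κ₁' : Matrix (Fin 4) (Fin 4) k) * κ₁ = 1 := by
  ext i j
  fin_cases i <;> fin_cases j <;> norm_num [κ₁, κ₁', torMat, Matrix.mul_apply, Fin.sum_univ_succ]

/-- `κ₃ κ₃' = 1`. -/
theorem κ₃_mul_κ₃' : (κ₃ : Matrix (Fin 4) (Fin 4) k) * κ₃' = 1 := by
  ext i j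
  fin_cases i <;> fin_cases j <;> norm_num [κ₃, κ₃', torMat, Matrix.mul_apply, Fin.sum_univ_succ]

/-- `κ₃' κ₃ = 1`. -/
theorem κ₃'_mul_κ₃ : (κ₃' : Matrix (Fin 4) (Fin 4) k) * κ₃ = 1 := by
  ext i j
  fin_cases i <;> fin_cases j <;> norm_num [κ₃, κ₃', torMat, Matrix.mul_apply, Fin.sum_univ_succ]

/-- `κ₂' κ₂'' = 1`. -/
theorem κ₂'_mul_κ₂'' : (κ₂' : Matrix (Fin 4) (Fin 4) k) * κ₂'' = 1 := by
  ext i j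
  fin_cases i <;> fin_cases j <;> norm_num [κ₂', κ₂'', Matrix.mul_apply, Fin.sum_univ_succ]

/-- `κ₂'' κ₂' = 1`. -/
theorem κ₂''_mul_κ₂' : (κ₂'' : Matrix (Fin 4) (Fin 4) k) * κ₂' = 1 := by
  ext i j
  fin_cases i <;> fin_cases j <;> norm_num [κ₂', κ₂'', Matrix.mul_apply, Fin.sum_univ_succ]

/-- `κ₂'` commutes with `Ω`. -/
theorem κ₂'_comm_Ω : (κ₂' : Matrix (Fin 4) (Fin 4) k) * (PlaneData.mixedRow q₀ 1 1).Ω =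
    (PlaneData.mixedRow q₀ 1 1).Ω * κ₂' := by
  rw [mixedRow_q₀_Ω]
  ext i j
  fin_cases i <;> fin_cases j <;> norm_num [κ₂', Matrix.mul_apply, Fin.sum_univ_succ]

/-- `κ₂'` preserves `B`. -/
theorem κ₂'_isometry : (κ₂' : Matrix (Fin 4) (Fin 4) k) * (PlaneData.mixedRow q₀ 1 1).B * κ₂'ᵀ =
    (PlaneData.mixedRow q₀ 1 1).B := by
  rw [mixedRow_q₀_B]
  ext i j
  fin_cases i <;> fin_cases j <;> norm_num [κ₂', Matrix.mul_apply, Matrix.transpose_apply, Fin.sum_univ_succ]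

/-- `κ₂'` commutes with the transported projector `g₀ P 0 g₀'`. -/
theorem κ₂'_comm_Q0 : (κ₂' : Matrix (Fin 4) (Fin 4) k) * (g₀ * (PlaneData.mixedRow q₀ 1 1).P 0 * g₀') =
    (g₀ * (PlaneData.mixedRow q₀ 1 1).P 0 * g₀') * κ₂' := by
  rw [mixedRow_q₀_P0]
  ext i j
  fin_cases i <;> fin_cases j <;> norm_num [κ₂', g₀, g₀', boostMat, Matrix.mul_apply, Fin.sum_univ_succ]

/-- `κ₂'` commutes with the transported projector `g₀ P 1 g₀'`. -/
theorem κ₂'_comm_Q1 : (κ₂' : Matrix (Fin 4) (Fin 4) k) * (g₀ * (PlaneData.mixedRow q₀ 1 1).P 1 * g₀') =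
    (g₀ * (PlaneData.mixedRow q₀ 1 1).P 1 * g₀') * κ₂' := by
  rw [mixedRow_q₀_P1]
  ext i j
  fin_cases i <;> fin_cases j <;> norm_num [κ₂', g₀, g₀', boostMat, Matrix.mul_apply, Fin.sum_univ_succ]

/-- Conjugating `κ₂'` back: `g₀' κ₂' g₀ = κ₂`. -/
theorem g₀'_κ₂'_g₀ : (g₀' : Matrix (Fin 4) (Fin 4) k) * κ₂' * g₀ = κ₂ := by
  ext i j
  fin_cases i <;> fin_cases j <;> norm_num [κ₂', κ₂, g₀, g₀', boostMat, torMat, Matrix.mul_apply, Fin.sum_univ_succ]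

/-- **The seesaw plane of the witness**: `U = ⟨1⟩ ⊕ ⟨−1⟩` (row convention, `q₀`) with the second torus transported by
the boost `g₀` — the shape `seesawPlane q a g g'` of the L4 skeleton with `q = q₀`, `a = 1`, `g = g₀`, `g' = g₀'`. -/
def W₀ : PlaneData k :=
  (PlaneData.mixedRow q₀ 1 1).withTransportedTorus g₀ g₀' g₀_mul_g₀' g₀'_mul_g₀ g₀_comm_Ω

/-- `Ω` of the witness plane. -/
theorem W₀_Ω : (W₀ : PlaneData k).Ω = (PlaneData.mixedRow q₀ 1 1).Ω := rfl

/-- `B` of the witness plane. -/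
theorem W₀_B : (W₀ : PlaneData k).B = (PlaneData.mixedRow q₀ 1 1).B := rfl

/-- `P` of the witness plane. -/
theorem W₀_P (i : Fin 2) : (W₀ : PlaneData k).P i = (PlaneData.mixedRow q₀ 1 1).P i := rfl

/-- `Q` of the witness plane: the transported projectors. -/
theorem W₀_Q (i : Fin 2) : (W₀ : PlaneData k).Q i = g₀ * (PlaneData.mixedRow q₀ 1 1).P i * g₀' := rfl

/-- The first letter `L₁ = diag(−w, −w̄)` at `w₀`. -/
def L₁ (w₀ : InfinitePlace k) : GA (W₀ : PlaneData k) :=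
  gaAtInf W₀ w₀ κ₁ κ₁' κ₁_mul_κ₁' κ₁'_mul_κ₁ (torMat_comm_Ω _ _ _ _)
    (torMat_isometry _ _ _ _ (by norm_num) (by norm_num))

/-- The transported letter `L₂ = g₀ diag(u, ū) g₀'` at `w₀`. -/
def L₂ (w₀ : InfinitePlace k) : GA (W₀ : PlaneData k) :=
  gaAtInf W₀ w₀ κ₂' κ₂'' κ₂'_mul_κ₂'' κ₂''_mul_κ₂' κ₂'_comm_Ω κ₂'_isometry

/-- The third letter `L₃ = diag(w, w̄)` at `w₀`. -/
def L₃ (w₀ : InfinitePlace k) : GA (W₀ : PlaneData k) :=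
  gaAtInf W₀ w₀ κ₃ κ₃' κ₃_mul_κ₃' κ₃'_mul_κ₃ (torMat_comm_Ω _ _ _ _)
    (torMat_isometry _ _ _ _ (by norm_num) (by norm_num))

/-- `L₁ ∈ localTorusAt W₀ w₀`. -/
theorem L₁_mem (w₀ : InfinitePlace k) : L₁ w₀ ∈ localTorusAt (W₀ : PlaneData k) w₀ :=
  Subgroup.mem_inf.2 ⟨Subgroup.mem_inf.2 ⟨gaAtInf_mem_commutant _ _ _ _ _ _ _ _ (torMat_comm_P0 _ _ _ _),
    gaAtInf_mem_commutant _ _ _ _ _ _ _ _ (torMat_comm_P1 _ _ _ _)⟩, gaAtInf_mem_atPlace _ _ _ _ _ _ _ _⟩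

/-- `L₃ ∈ localTorusAt W₀ w₀`. -/
theorem L₃_mem (w₀ : InfinitePlace k) : L₃ w₀ ∈ localTorusAt (W₀ : PlaneData k) w₀ :=
  Subgroup.mem_inf.2 ⟨Subgroup.mem_inf.2 ⟨gaAtInf_mem_commutant _ _ _ _ _ _ _ _ (torMat_comm_P0 _ _ _ _),
    gaAtInf_mem_commutant _ _ _ _ _ _ _ _ (torMat_comm_P1 _ _ _ _)⟩, gaAtInf_mem_atPlace _ _ _ _ _ _ _ _⟩

/-- `L₂ ∈ localTorusAt' W₀ w₀`. -/
theorem L₂_mem (w₀ : InfinitePlace k) : L₂ w₀ ∈ localTorusAt' (W₀ : PlaneData k) w₀ :=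
  Subgroup.mem_inf.2 ⟨Subgroup.mem_inf.2 ⟨gaAtInf_mem_commutant _ _ _ _ _ _ _ _ κ₂'_comm_Q0,
    gaAtInf_mem_commutant _ _ _ _ _ _ _ _ κ₂'_comm_Q1⟩, gaAtInf_mem_atPlace _ _ _ _ _ _ _ _⟩

/-- **The word** `L₁ · L₂ · L₃ · L₂` (tags: `T, T′, T, T′`). -/
def theWord (w₀ : InfinitePlace k) : List (GA (W₀ : PlaneData k) × Bool) :=
  [(L₁ w₀, true), (L₂ w₀, false), (L₃ w₀, true), (L₂ w₀, false)]

/-- The word is a `(T, T′)`-word at `w₀`. -/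
theorem theWord_isJointWord (w₀ : InfinitePlace k) : IsJointWord (W₀ : PlaneData k) w₀ (theWord w₀) := by
  intro p hp
  simp only [theWord, List.mem_cons, List.not_mem_nil, or_false] at hp
  rcases hp with rfl | rfl | rfl | rfl
  · exact ⟨fun _ => L₁_mem w₀, fun h => by simp at h⟩
  · exact ⟨fun h => by simp at h, fun _ => L₂_mem w₀⟩
  · exact ⟨fun _ => L₃_mem w₀, fun h => by simp at h⟩
  · exact ⟨fun h => by simp at h, fun _ => L₂_mem w₀⟩

/-- **The word has product `1`** (the relation `κ₁ κ₂' κ₃ κ₂' = 1` placed at `w₀`). -/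
theorem theWord_prod (w₀ : InfinitePlace k) : wordProd (W₀ : PlaneData k) (theWord w₀) = 1 := by
  apply GA.ext_mat
  show GA.mat W₀ (L₁ w₀ * (L₂ w₀ * (L₃ w₀ * (L₂ w₀ * 1)))) = GA.mat W₀ 1
  rw [mul_one]
  simp only [GA.mat_mul, L₁, L₂, L₃, gaAtInf_mat]
  rw [← atInf_mul, ← atInf_mul, ← atInf_mul]
  have h : (κ₁ : Matrix (Fin 4) (Fin 4) k) * (κ₂' * (κ₃ * κ₂')) = 1 := by
    simpa only [mul_assoc] using (word_eq_one (k := k))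
  rw [h, atInf_one]
  rfl

omit [NumberField k] in
/-- `ω_{w₀} = i` for `q₀` (`t = 0`, `n = 1`). -/
theorem wroot_q₀ (w₀ : InfinitePlace k) : wroot (q₀ : QuadData k) w₀ = Complex.I := by
  have h4 : Real.sqrt 4 = 2 := by
    rw [show (4 : ℝ) = 2 ^ 2 by norm_num, Real.sqrt_sq (by norm_num)]
  simp only [wroot, q₀, map_zero, map_one, Complex.zero_re, Complex.one_re, mul_one, zero_add, ne_eq,
    OfNat.ofNat_ne_zero, not_false_eq_true, zero_pow, sub_zero, h4]
  push_cast
  ring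


/-- The weights of `L₁` at `w₀`: `(−w, −w̄)`. -/
theorem weightAt_L₁ (w₀ : InfinitePlace k) :
    weightAt (W₀ : PlaneData k) q₀ w₀ 0 (L₁ w₀) = -wC ∧
      weightAt (W₀ : PlaneData k) q₀ w₀ 1 (L₁ w₀) = -(84 / 85 - 13 / 85 * Complex.I) := by
  constructor
  · simp only [weightAt, lineBase, lineOmega, ↓reduceIte, L₁, entryAt_gaAtInf, wroot_q₀, κ₁, torMat]
    simp only [Matrix.of_apply, Matrix.cons_val', Matrix.cons_val_zero, Matrix.cons_val_one,
      Matrix.empty_val', Matrix.cons_val_fin_one, map_div₀, map_neg, map_ofNat, wC]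
    ring
  · simp only [weightAt, lineBase, lineOmega, Fin.one_eq_zero_iff, OfNat.ofNat_ne_one, ↓reduceIte, L₁,
      entryAt_gaAtInf, wroot_q₀, κ₁, torMat]
    simp only [Matrix.of_apply, Matrix.cons_val', Matrix.cons_val_zero, Matrix.cons_val_one,
      Matrix.cons_val_two, Matrix.cons_val_three, Matrix.vecHead, Matrix.vecTail, Matrix.empty_val',
      Matrix.cons_val_fin_one, Function.comp_apply, Fin.succ_zero_eq_one, Fin.succ_one_eq_two, map_div₀, map_neg,
      map_ofNat]
    ring

/-- The weights of `L₃` at `w₀`: `(w, w̄)`. -/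
theorem weightAt_L₃ (w₀ : InfinitePlace k) :
    weightAt (W₀ : PlaneData k) q₀ w₀ 0 (L₃ w₀) = wC ∧
      weightAt (W₀ : PlaneData k) q₀ w₀ 1 (L₃ w₀) = 84 / 85 - 13 / 85 * Complex.I := by
  constructor
  · simp only [weightAt, lineBase, lineOmega, ↓reduceIte, L₃, entryAt_gaAtInf, wroot_q₀, κ₃, torMat]
    simp only [Matrix.of_apply, Matrix.cons_val', Matrix.cons_val_zero, Matrix.cons_val_one,
      Matrix.empty_val', Matrix.cons_val_fin_one, map_div₀, map_ofNat, wC]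
  · simp only [weightAt, lineBase, lineOmega, Fin.one_eq_zero_iff, OfNat.ofNat_ne_one, ↓reduceIte, L₃,
      entryAt_gaAtInf, wroot_q₀, κ₃, torMat]
    simp only [Matrix.of_apply, Matrix.cons_val', Matrix.cons_val_zero, Matrix.cons_val_one,
      Matrix.cons_val_two, Matrix.cons_val_three, Matrix.vecHead, Matrix.vecTail, Matrix.empty_val',
      Matrix.cons_val_fin_one, Function.comp_apply, Fin.succ_zero_eq_one, Fin.succ_one_eq_two, map_div₀, map_neg,
      map_ofNat]
    ring

/-- The transported weights of `L₂` at `w₀`: `(u, ū)` (read in the frame `g₀' κ₂' g₀ = κ₂`). -/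
theorem weightAt'_L₂ (w₀ : InfinitePlace k) :
    weightAt' (W₀ : PlaneData k) q₀ w₀ g₀ g₀' 0 (L₂ w₀) = uC ∧
      weightAt' (W₀ : PlaneData k) q₀ w₀ g₀ g₀' 1 (L₂ w₀) = 533 / 925 - 756 / 925 * Complex.I := by
  constructor
  · simp only [weightAt', lineBase, lineOmega, ↓reduceIte, L₂, entryAtConj_gaAtInf, wroot_q₀, g₀'_κ₂'_g₀, κ₂,
      torMat]
    simp only [Matrix.of_apply, Matrix.cons_val', Matrix.cons_val_zero, Matrix.cons_val_one,
      Matrix.empty_val', Matrix.cons_val_fin_one, map_div₀, map_ofNat, uC]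
  · simp only [weightAt', lineBase, lineOmega, Fin.one_eq_zero_iff, OfNat.ofNat_ne_one, ↓reduceIte, L₂,
      entryAtConj_gaAtInf, wroot_q₀, g₀'_κ₂'_g₀, κ₂, torMat]
    simp only [Matrix.of_apply, Matrix.cons_val', Matrix.cons_val_zero, Matrix.cons_val_one,
      Matrix.cons_val_two, Matrix.cons_val_three, Matrix.vecHead, Matrix.vecTail, Matrix.empty_val',
      Matrix.cons_val_fin_one, Function.comp_apply, Fin.succ_zero_eq_one, Fin.succ_one_eq_two, map_div₀, map_neg,
      map_ofNat]
    ring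

/-- The joint weight of the letter `(L₁, T)`: `(−w)^(eP − eM)`. -/
theorem jointWeight_L₁ (w₀ : InfinitePlace k) (eP eM eP' eM' : InfinitePlace k → ℤ) :
    jointWeight (W₀ : PlaneData k) q₀ w₀ g₀ g₀' eP eM eP' eM' (L₁ w₀, true) = (-wC) ^ (eP w₀ - eM w₀) := by
  simp only [jointWeight, ↓reduceIte, (weightAt_L₁ w₀).1, (weightAt_L₁ w₀).2]
  exact zpow_pair (by rw [neg_mul_neg]; exact wC_mul_conj) _ _

/-- The joint weight of the letter `(L₃, T)`: `w^(eP − eM)`. -/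
theorem jointWeight_L₃ (w₀ : InfinitePlace k) (eP eM eP' eM' : InfinitePlace k → ℤ) :
    jointWeight (W₀ : PlaneData k) q₀ w₀ g₀ g₀' eP eM eP' eM' (L₃ w₀, true) = wC ^ (eP w₀ - eM w₀) := by
  simp only [jointWeight, ↓reduceIte, (weightAt_L₃ w₀).1, (weightAt_L₃ w₀).2]
  exact zpow_pair wC_mul_conj _ _

/-- The joint weight of the letter `(L₂, T′)`: `u^(eP′ − eM′)`. -/
theorem jointWeight_L₂ (w₀ : InfinitePlace k) (eP eM eP' eM' : InfinitePlace k → ℤ) :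
    jointWeight (W₀ : PlaneData k) q₀ w₀ g₀ g₀' eP eM eP' eM' (L₂ w₀, false) = uC ^ (eP' w₀ - eM' w₀) := by
  simp only [jointWeight, Bool.false_eq_true, ↓reduceIte, (weightAt'_L₂ w₀).1, (weightAt'_L₂ w₀).2]
  exact zpow_pair uC_mul_conj _ _

/-- The weight of the word: `(−w)^e · u^e′ · w^e · u^e′` with `e = eP − eM`, `e′ = eP′ − eM′` at `w₀`. -/
theorem wordWeight_theWord (w₀ : InfinitePlace k) (eP eM eP' eM' : InfinitePlace k → ℤ) :
    wordWeight (W₀ : PlaneData k) q₀ w₀ g₀ g₀' eP eM eP' eM' (theWord w₀) =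
      (-wC) ^ (eP w₀ - eM w₀) * (uC ^ (eP' w₀ - eM' w₀) * (wC ^ (eP w₀ - eM w₀) * (uC ^ (eP' w₀ - eM' w₀) * 1))) := by
  simp only [wordWeight, theWord, List.map_cons, List.map_nil, List.prod_cons, List.prod_nil, jointWeight_L₁,
    jointWeight_L₂, jointWeight_L₃]



/-- **THE WEIGHT DEFECT**: for `eP w₀ − eM w₀ = ±3` and `eP′ w₀ − eM′ w₀ = ±3` the weight of the word is `≠ 1`
(its real part is negative in all four cases: `−0.929…` or `−0.106…`). -/
theorem wordWeight_theWord_ne_one (w₀ : InfinitePlace k) (eP eM eP' eM' : InfinitePlace k → ℤ)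
    (he : eP w₀ - eM w₀ = 3 ∨ eP w₀ - eM w₀ = -3) (he' : eP' w₀ - eM' w₀ = 3 ∨ eP' w₀ - eM' w₀ = -3) :
    wordWeight (W₀ : PlaneData k) q₀ w₀ g₀ g₀' eP eM eP' eM' (theWord w₀) ≠ 1 := by
  rw [wordWeight_theWord]
  rcases he with h | h <;> rcases he' with h' | h' <;> rw [h, h']
  · rw [neg_wC_zpow_three, wC_zpow_three, uC_zpow_three]
    intro hh
    have hre := congrArg Complex.re hh
    norm_num at hre
  · rw [neg_wC_zpow_three, wC_zpow_three, uC_zpow_neg_three]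
    intro hh
    have hre := congrArg Complex.re hh
    norm_num at hre
  · rw [neg_wC_zpow_neg_three, wC_zpow_neg_three, uC_zpow_three]
    intro hh
    have hre := congrArg Complex.re hh
    norm_num at hre
  · rw [neg_wC_zpow_neg_three, wC_zpow_neg_three, uC_zpow_neg_three]
    intro hh
    have hre := congrArg Complex.re hh
    norm_num at hre

/-- **THE JOINT `K`-TYPE SPACE OF THE WITNESS PLANE IS ZERO**: at any infinite place `w₀`, for any exponents with
`eP w₀ − eM w₀ = ±3` and `eP′ w₀ − eM′ w₀ = ±3`, `kTypeSpace W₀ q₀ g₀ g₀' eP eM eP' eM' K V = ⊥` for EVERY `V` and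
EVERY level `K` — the joint `(T, T′)`-equivariance has only the zero vector. -/
theorem kTypeSpace_witness_eq_bot (w₀ : InfinitePlace k) (eP eM eP' eM' : InfinitePlace k → ℤ)
    (he : eP w₀ - eM w₀ = 3 ∨ eP w₀ - eM w₀ = -3) (he' : eP' w₀ - eM' w₀ = 3 ∨ eP' w₀ - eM' w₀ = -3)
    (K : Subgroup (GA (W₀ : PlaneData k))) (V : Submodule ℂ (GA (W₀ : PlaneData k) → ℂ)) :
    kTypeSpace (W₀ : PlaneData k) q₀ g₀ g₀' eP eM eP' eM' K V = ⊥ :=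
  kTypeSpace_eq_bot_of_word W₀ q₀ w₀ g₀ g₀' eP eM eP' eM' K V (theWord w₀) (theWord_isJointWord w₀)
    (theWord_prod w₀) (wordWeight_theWord_ne_one w₀ eP eM eP' eM' he he')

/-- **The wall's Riesz clause fails on the witness plane**: no `f` is a Riesz vector on
`kTypeSpace W₀ q₀ g₀ g₀' eP eM eP' eM' K V`, for any `V`, `K`, `R`, `μ`, `D_G`. -/
theorem not_exists_isRieszVectorOn_witness [MeasurableSpace (torusT (W₀ : PlaneData k))]
    [MeasurableSpace (torusT' (W₀ : PlaneData k))] (R : RTFData (W₀ : PlaneData k))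
    [MeasurableSpace (GA (W₀ : PlaneData k))] (μ : MeasureTheory.Measure (GA (W₀ : PlaneData k)))
    (DG : Set (GA (W₀ : PlaneData k))) (w₀ : InfinitePlace k) (eP eM eP' eM' : InfinitePlace k → ℤ)
    (he : eP w₀ - eM w₀ = 3 ∨ eP w₀ - eM w₀ = -3) (he' : eP' w₀ - eM' w₀ = 3 ∨ eP' w₀ - eM' w₀ = -3)
    (K : Subgroup (GA (W₀ : PlaneData k))) (V : Submodule ℂ (GA (W₀ : PlaneData k) → ℂ)) :
    ¬ ∃ f : GA (W₀ : PlaneData k) → ℂ,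
      IsRieszVectorOn R μ DG (kTypeSpace (W₀ : PlaneData k) q₀ g₀ g₀' eP eM eP' eM' K V) f :=
  not_exists_isRieszVectorOn_of_word R μ DG q₀ w₀ g₀ g₀' eP eM eP' eM' K V (theWord w₀) (theWord_isJointWord w₀)
    (theWord_prod w₀) (wordWeight_theWord_ne_one w₀ eP eM eP' eM' he he')

/-- **Every bi-`(T, T′)`-equivariant function on the witness plane is `0`**: the hypotheses `hfT`, `hfT'` of t4-L4-p1's
`KTypeTransport.rightRegular_mem_kTypeSpace` at the place `w₀` (with these exponents) have only the zero instance. -/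
theorem eq_zero_of_left_equivariant_witness (w₀ : InfinitePlace k) (eP eM eP' eM' : InfinitePlace k → ℤ)
    (he : eP w₀ - eM w₀ = 3 ∨ eP w₀ - eM w₀ = -3) (he' : eP' w₀ - eM' w₀ = 3 ∨ eP' w₀ - eM' w₀ = -3)
    (f : GA (W₀ : PlaneData k) → ℂ)
    (hfT : ∀ κ : GA (W₀ : PlaneData k), κ ∈ localTorusAt W₀ w₀ → ∀ y,
      f (κ⁻¹ * y) = weightAt W₀ q₀ w₀ 0 κ ^ eP w₀ * weightAt W₀ q₀ w₀ 1 κ ^ eM w₀ * f y)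
    (hfT' : ∀ κ : GA (W₀ : PlaneData k), κ ∈ localTorusAt' W₀ w₀ → ∀ y,
      f (κ⁻¹ * y) = weightAt' W₀ q₀ w₀ g₀ g₀' 0 κ ^ eP' w₀ * weightAt' W₀ q₀ w₀ g₀ g₀' 1 κ ^ eM' w₀ * f y) :
    f = 0 :=
  eq_zero_of_left_equivariant_of_word W₀ q₀ w₀ g₀ g₀' eP eM eP' eM' f hfT hfT' (theWord w₀)
    (theWord_isJointWord w₀) (theWord_prod w₀) (wordWeight_theWord_ne_one w₀ eP eM eP' eM' he he')

end Witness

end Summit.Ventures.HodgeRepro.Tier4.Line4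

end
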